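import Summits.AtomisticToContinuum.Crystallization.Theses.PRVarianceCertificate
import Summits.AtomisticToContinuum.Crystallization.Theorems.PRVarianceCertificateCoerciveVarianceCertificateOptimalHcp
import Summits.AtomisticToContinuum.Crystallization.Theorems.PRVarianceCertificateCoerciveVarianceCertificateHcpEnergyBound
import Summits.AtomisticToContinuum.Crystallization.Theorems.PRVarianceCertificateCoerciveVarianceCertificatePricingSmall
import HarnessLib

/-!
# Line `birth` for crux `CoerciveVarianceCertificate` (stmt-AtomisticToContinuum-11860) — birth skeleton (BC3)

Crux (route `PRVarianceCertificate`, rank 3, = X of the thesis): there are a periodic `P ⊂ ℝ³` and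
`C > 0` with `e_LJ(P) ≤ −C/24` such that for every `R, ε > 0` some `c(R, ε) > 0` gives, for every
Lennard-Jones ground state `x` of `N ≥ 2` particles,
`c · #{i : the R-window of x at x_i is not ε-congruent (linear isometry) to a window of P} ≤ C·Σ_i t_i − Σ_i s_i²`
(`s_i = Σ_{j ≠ i} r_ij⁻⁶`, `t_i = Σ_{j ≠ i} r_ij⁻¹²`; the matching predicate is that of the hinge
`BulkDefectVanish`).

## The line: SCALE SEPARATION — price defects at ONE coarse resolution, propagate order to every resolution

The crux asks for a rate `c(R, ε)` at EVERY resolution. The certificate's mechanism (effective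
coordination `n_i := s_i²/t_i` versus `Φ(hcp) = C`, `d_i := C t_i − s_i² = t_i (C − n_i)`) lives at the
scale of two coordination shells; everything finer is deficit-free geometry of ground states. So:

* `stub_optimalHcp` (M, provable now in principle: continuity + coercivity of the two-parameter lattice
  sum) — the relaxed Lennard-Jones hcp exists: some `(a, h)`, `a, h > 0`, minimises
  `e_LJ(hcp_{a',h'})` over all `a', h' ≠ 0` (`hcpPeriodicConfiguration`, in-layer spacing `a`, layer
  spacing `h`; intended `h/a ≈ √(2/3)` up to the `1e-4`-level `c/a` relaxation, `a` the optimal dilation,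
  `e = −Φ(hcp)/24 = −17.2222/24`). This PINS the template `P := hcp_{a,h}` (scale included) for the
  other two stubs, which are stated for every such optimal pair (unique up to the sign symmetries
  `a ↦ −a`, `h ↦ −h`, which give congruent point sets).
* `stub_coarsePricing` (XL, the certificate half; hardest) — COARSE PRICING BY DEFICIT: with
  `C := Φ(hcp_{a,h})` (so `e(P) ≤ −C/24`) there is `c₀ > 0` such that every LJ ground state `x`
  (`N ≥ 2`) has `c₀ · #{i : the (2a)-window at x_i is NOT (a/100)-congruent to a window of P} ≤ C·Σt − Σs²`.
  One fixed resolution `(R₀, ε₀) = (2a, a/100)`: it prices surface sites (`d ≈ s̄²/4` each), vacancies,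
  polytetrahedral order (shell credit ≫ centre debt), grain boundaries, and c-type (fcc) layers
  (`d = (Φ_hcp − Φ_fcc) t ≈ 0.022` per site) — i.e. the route's foreseen `LocalDeficitRigidity` +
  `StackingDeficit`, at two shells only, plus the elastic haloes of defects (strain `> 1/200` within
  `≈ 30 b` of a dislocation, paid by core + second-order strain deficit; `c₀` small but positive).
  It contains `GroundStateVarianceCertificate` pinned at hcp (take `# ≥ 0`).
* `stub_coarseToFine` (L/XL, deficit-free) — COARSE-TO-FINE RIGIDITY WITH SCALE PINNING: for every
  `R, ε > 0` there is `L` such that in every LJ ground state, if EVERY particle within `L` of `x_i` has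
  its `(2a)`-window `(a/100)`-congruent to a window of `P`, then the `R`-window at `x_i` is
  `ε`-congruent to a window of `P`. Content: overlapping two-shell hcp windows on a ball glue to ONE
  rotated hcp crystal (no c-layers, no dislocations inside), interior elastic regularity for
  equilibria makes strain and lattice rotation gradients `O(1/L)`-small at the centre (sources of
  internal stress are the excluded defects and the surface), and the ground-state property pins the
  lattice parameters to the optimal `(a, h)` (a defect-free region strained by `η` of radius
  `≳ 1/(K η²)` is improvable by a compactly supported compression — this is where `stub_optimalHcp`'s
  optimality is used; for a non-optimal template the statement would be false).
* `CoerciveVarianceCertificate_of` — the kernel-checked composition (no `sorry` outside `stub_*`):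
  `P := hcp_{a,h}`, `C, c₀` from pricing, `L(R, ε)` from rigidity, `δ = ` the uniform minimal distance
  of LJ ground states (`LennardJonesMinimalDistance_holds`, proved in tree), packing bound
  `#{j : |x_j − x_i| ≤ L} ≤ K := (2L/δ + 1)³` (`card_le_of_separated_of_dist_le`), and
  `c(R, ε) := c₀ / K`: every `(R, ε)`-bad particle has an `(R₀, ε₀)`-bad particle within `L`
  (contrapositive of rigidity), so `#bad_{R,ε} ≤ K · #bad_{R₀,ε₀}` and
  `c · #bad_{R,ε} ≤ c₀ · #bad_{R₀,ε₀} ≤ C·Σt − Σs²`.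

Neither substantive stub is the crux re-packaged: pricing is a SINGLE-resolution, hcp-pinned statement
(the crux's `∀ R ε` uniformity and all long-range order are gone), rigidity carries no deficit at all;
the crux needs both plus the packing count. Registered signatures are fully inlined one-liners over
tree declarations (`hcpPeriodicConfiguration`, `energyPerParticle`, `IsGroundState`, `siteEnergy`).

Disproof.lean: none exists for this crux yet (`ledger crux ls stmt-AtomisticToContinuum-11860`: no
workfiles, 2026-08-17).  Negatives index (`ledger negatives`, 20 entries, 4 in this sub) checked:
3506 `OneGrainGluing` (multiplicity pile-up on non-injective configurations — both stubs here speak of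
LJ ground states only, injective and uniformly separated); 17253 `OneMultiplierPricing` (pricing LINEAR
in the mismatch `τ`, killed by the dilated ground states `(1+s)·x^N` — `stub_coarsePricing` prices ONE
fixed tolerance `a/100` with an existential constant and never applies to dilates, which are not ground
states; the deficit it spends is the certificate's, not an energy excess); 4146 / 15929 (first-shell
censuses — no shell alphabet is asserted: matching is metric congruence of whole `2a`-windows to the
hcp template).  `stub_coarseToFine` quantifies `L` after `(R, ε)` and assumes the ground-state property
and the OPTIMAL template, the two hypotheses without which it is false (strained or mis-scaled hcp).

RESHAPE (lead c1, 2026-08-17): `stub_coarsePricing` is split into `stub_hcpEnergyBound` (size S, provable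
now from the tree's certified trial value `stub_offBoxRef`: `e(hcp_{a,h}) ≤ −0.7175` at every optimal pair) and
`stub_pricing` (the open kernel, certificate constant PINNED to `C := −24·e(hcp_{a,h})`; no loss of generality
since an admissible `C' ≤ C` only shrinks the deficit); `coarsePricing_of_pinned` recovers the free-constant
statement; `stub_pricing` is further cut BY PARTICLE NUMBER into `stub_pricingSmall` (2 ≤ N ≤ 18: provable now —
participation `n_i ≤ N − 1 < C`, virial identity, `E(N) ≤ −1/12`; rate 1/50 for ANY count ≤ N) and
`stub_pricingLarge` (N ≥ 19: the open kernel), glued by `pricing_of_small_large` (`c₀' = min (1/50) c₀`);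
`CoerciveVarianceCertificate_of` now takes the five stub statements.  Stubs: 5 ≤ stubs_max = 7.

STATUS (lead c2, 2026-08-17, wave 1): `stub_optimalHcp`, `stub_hcpEnergyBound`, `stub_pricingSmall` LANDED
(p145271 / p145251 / p146150, `Theorems/PRVarianceCertificateCoerciveVarianceCertificate{OptimalHcp,HcpEnergyBound,
PricingSmall}.lean`, namespace `…Theorems.PRVarianceCertificate.CoerciveVarianceCertificate`) and are consumed below by
name (the three `stub_*` theorems of this file are now one-line aliases, no `sorry`).  OPEN: `stub_pricingLarge` —
crux-sized: with `0 ≤ c₀·#` it is crux 11859 `GroundStateVarianceCertificate` pinned at `P = hcp`, `C = Φ(hcp)`,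
`N ≥ 19` (kernel-checked glue attached to the item as evidence `pricingLarge-contains-11859.lean`; crux 11859's own
line has the same open kernel `stub_coreDomination`); `stub_coarseToFine` — blocked on facts absent from the tree
(two-shell hcp window gluing; interior elastic regularity of LJ equilibria; scale pinning by minimality — the optimal
pair IS unique: `LayeredLawsSelectHcp.tube_hcpE_unique_minimiser`, enclosure `a₀ = 0.97129 ± 1e-4`,
`h₀ = 0.79294 ± 1e-4`).  Lead numerics (evidence `polytype-psi-evidence.md`): hcp is the strict `Ψ`-maximiser among
Barlow polytypes (h-sites `n = Φ(hcp) ± 3e-6` in every stacking, c-sites `n ≤ Φ(hcp) − 8.7e-4`), so the pinned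
constant survives and `c₀ ≲ 0.0106` (≈ 0.003 around an isolated growth fault); Mackay clusters `N ≤ 309` have
`Ψ ≤ 13.6`.

STATUS (lead c3, 2026-08-17, wave 2): no stub moved in its main case; two helper files LANDED `--supports`:
`Theorems/PRVarianceCertificateCoerciveVarianceCertificateMatching.lean` (p150185, 21 decls: monotonicity of the two-way
matching predicate `matched_mono` / `card_unmatched_mono`; the DEGENERATE REGIMES of `stub_coarseToFine` —
`(R ≤ 2a ∧ a/100 ≤ ε) ∨ R ≤ ε`, any configuration, `L = 1` — as the registered sub-goal `coarseToFine_degenerateRegimes`;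
exposed vertices are never matched when the template spans (`exists_not_matched`, `hcp_spans`); the optimal pair is
pinned, `a = 0.97129 ± 1e-4`, `h = 0.79294 ± 1e-4` (`optimalHcp_enclosure`)) and
`Theorems/PRVarianceCertificateCoerciveVarianceCertificateNecessity.lean` (p150793, the NECESSITY chain by name:
`CoerciveVarianceCertificate → GroundStateVarianceCertificate` (11859) `→ CrysPeriodicMinAttained` (0627),
`→ BulkDefectVanish` (0751), `→ _root_.Crystallization` via `closes` with every support discharged; and
`coerciveWitness_rigid`: every witness has `e(P) = min_Q e(Q)`, `C = −24 e(P)`, `E(N)/N → e(P)`).  Consequence,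
kernel-checked: a proof of this crux is a proof of the whole sub-problem `Crystallization`; every skeleton for it
carries item 0627 ("completely open in dimension three") inside some stub — here inside `stub_pricingLarge`
(⊇ 11859 at P = hcp), while the main case of `stub_coarseToFine` (`ε < R ∧ (2a < R ∨ ε < a/100)`) needs three facts
absent from tree and print: (G) gluing of two-shell hcp windows into one chart, (P1) interior elastic regularity of
LJ equilibria, (P2) scale pinning by global minimality (signatures in the lead's `work/stubs/stub_coarseToFine.missing.md`,
attached as evidence).  Verdict this cycle: `blocked-on: stmt-AtomisticToContinuum-11859` (necessary by
`groundStateVarianceCertificate_of_coerciveVarianceCertificate`; the planner's own `[deps]`).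

BC3 probes (this session, files `bc/*_probe*.lean` in the registrar's folder): for each stub `S`,
`example : S → CoerciveVarianceCertificate` and `example : S → _root_.Crystallization` by
`first | exact? | simpa | aesop` FAIL (see NOTES.md of planner-skel-stmt-AtomisticToContinuum-11860-0).
-/

noncomputable section

namespace Summit.AtomisticToContinuum.Crystallization.Cruxes.CoerciveVarianceCertificate.Birth

open scoped BigOperators

/-! ## Registered stubs (sorries live ONLY here; signatures fully inlined, one line each) -/

/-- **STUB 0 — the relaxed Lennard-Jones hcp exists** (size M; provable now in principle).  Some
`a, h > 0` minimise the Lennard-Jones energy per particle of `hcpPeriodicConfiguration` over all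
parameters `a', h' ≠ 0` (in-layer spacing, layer spacing).  Why true: `(a, h) ↦ e(hcp_{a,h})` is
continuous on `(ℝ ∖ 0)²`, even in each variable, `→ +∞` as `a → 0` or `h → 0` (the `r⁻¹²` term),
tends to the (negative, but `> −0.3`) chain / triangular-layer / zero limits as `a` or `h → ∞`, and takes
the value `≈ −0.7176 = −Φ(hcp)/24` near `(a, h) ≈ (0.971, 0.971·√(2/3))`; so the infimum is attained on
a compact set.  Leans on: `hcpPeriodicConfiguration`, `PeriodicConfiguration.energyPerParticle`
(tsum; summable in `d = 3`), `HcpHomogeneous` / `PeriodicConfigurationSums` for the lattice sums. -/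
theorem stub_optimalHcp : ∃ (a h : ℝ) (ha : 0 < a) (hh : 0 < h), (∀ (a' h' : ℝ) (ha' : a' ≠ 0) (hh' : h' ≠ 0), (Literature.MathematicalPhysics.StatisticalMechanics.hcpPeriodicConfiguration ha.ne' hh.ne').energyPerParticle Literature.MathematicalPhysics.StatisticalMechanics.lennardJones ≤ (Literature.MathematicalPhysics.StatisticalMechanics.hcpPeriodicConfiguration ha' hh').energyPerParticle Literature.MathematicalPhysics.StatisticalMechanics.lennardJones) :=
  -- LANDED: Theorems/PRVarianceCertificateCoerciveVarianceCertificateOptimalHcp (p145271)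
  Summit.AtomisticToContinuum.Crystallization.Theorems.PRVarianceCertificate.CoerciveVarianceCertificate.stub_optimalHcp

/-- **STUB 1a — the certificate constant** (size S; provable now).  For every optimal hcp parameter
pair `(a, h)` the Lennard-Jones energy per particle satisfies `e_LJ(hcp_{a,h}) ≤ −0.7175`, so that the
pinned certificate constant `C := −24·e_LJ(hcp_{a,h})` (`= Φ(hcp) ≈ 17.2222`) is `≥ 17.22 > 0` and
`e = −C/24` exactly.  Why true: the tree holds the certified trial value
`SquareWellLayerCake.StackingFaultSparsity.stub_offBoxRef : e(hcp_{0.9713, 0.9713·0.8164}) ≤ −0.7175`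
(interval lattice sums), and optimality compares.  Leans on: `stub_offBoxRef` (landed),
`hcpPeriodicConfiguration`. -/
theorem stub_hcpEnergyBound : ∀ (a h : ℝ) (ha : 0 < a) (hh : 0 < h), (∀ (a' h' : ℝ) (ha' : a' ≠ 0) (hh' : h' ≠ 0), (Literature.MathematicalPhysics.StatisticalMechanics.hcpPeriodicConfiguration ha.ne' hh.ne').energyPerParticle Literature.MathematicalPhysics.StatisticalMechanics.lennardJones ≤ (Literature.MathematicalPhysics.StatisticalMechanics.hcpPeriodicConfiguration ha' hh').energyPerParticle Literature.MathematicalPhysics.StatisticalMechanics.lennardJones) → (Literature.MathematicalPhysics.StatisticalMechanics.hcpPeriodicConfiguration ha.ne' hh.ne').energyPerParticle Literature.MathematicalPhysics.StatisticalMechanics.lennardJones ≤ -(7175 / 10000) :=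
  -- LANDED: Theorems/PRVarianceCertificateCoerciveVarianceCertificateHcpEnergyBound (p145251)
  Summit.AtomisticToContinuum.Crystallization.Theorems.PRVarianceCertificate.CoerciveVarianceCertificate.stub_hcpEnergyBound

/-- **STUB 1b — small clusters are priced by participation** (size S/M; provable now; lead's).  If
`e_LJ(hcp_{a,h}) ≤ −0.7175` (so `C := −24·e ≥ 17.22`) then every Lennard-Jones ground state `x` of
`2 ≤ N ≤ 18` particles has `N/50 ≤ C·Σ_i t_i − Σ_i s_i²` — hence ANY defect count (`≤ N`) is priced at
rate `1/50`.  Mechanism (the certificate's, at its crudest): the effective coordination `n_i = s_i²/t_i` is a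
participation number, `≤ N − 1 ≤ 17 < C` by Cauchy–Schwarz; the virial identity of a ground state
(`λ ↦ E(λx)` is minimal at `λ = 1`) gives `Σs = Σt = −24·E(N)`, and `E(N) ≤ E(2) ≤ V_LJ(1) = −1/12`
(`groundStateEnergy_add_lt`, dimer trial state) gives `Σt ≥ 2`; so the deficit is `≥ 0.22·Σt ≥ 0.44 ≥ N/50`.
Leans on: `two_mul_interactionEnergy_lennardJones_eq_inv_pow`, `groundStateEnergy_add_lt`,
`siteEnergy_nonpos_of_isGroundState`, `LennardJonesGroundStatesExist_holds` (all landed). -/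
theorem stub_pricingSmall : ∀ (a h : ℝ) (ha : 0 < a) (hh : 0 < h), (Literature.MathematicalPhysics.StatisticalMechanics.hcpPeriodicConfiguration ha.ne' hh.ne').energyPerParticle Literature.MathematicalPhysics.StatisticalMechanics.lennardJones ≤ -(7175 / 10000) → ∀ (N : ℕ) (x : Fin N → EuclideanSpace ℝ (Fin 3)), Literature.MathematicalPhysics.StatisticalMechanics.IsGroundState Literature.MathematicalPhysics.StatisticalMechanics.lennardJones x → 2 ≤ N → N ≤ 18 → (1 / 50 : ℝ) * N ≤ (-(24 : ℝ) * (Literature.MathematicalPhysics.StatisticalMechanics.hcpPeriodicConfiguration ha.ne' hh.ne').energyPerParticle Literature.MathematicalPhysics.StatisticalMechanics.lennardJones) * ∑ i, Literature.MathematicalPhysics.StatisticalMechanics.siteEnergy (fun r => (r⁻¹) ^ 12) x i - ∑ i, (Literature.MathematicalPhysics.StatisticalMechanics.siteEnergy (fun r => (r⁻¹) ^ 6) x i) ^ 2 :=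
  -- LANDED: Theorems/PRVarianceCertificateCoerciveVarianceCertificatePricingSmall (p146150)
  Summit.AtomisticToContinuum.Crystallization.Theorems.PRVarianceCertificate.CoerciveVarianceCertificate.stub_pricingSmall

/-- **STUB 1c — coarse pricing by deficit for `N ≥ 19`, constant pinned** (size XL; the certificate
half, hardest; THE OPEN KERNEL of the line).  For every optimal hcp pair `(a, h)`, with the certificate
constant PINNED to `C := −24·e_LJ(hcp_{a,h}) = Φ(hcp)` (no loss: any admissible `C' ≤ C` gives a smaller
deficit), there is `c₀ > 0` such that every Lennard-Jones ground state `x` of `N ≥ 19` particles satisfies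
`c₀ · #{i : the 2a-window at x_i is not (a/100)-congruent, by a linear isometry, to a window of hcp_{a,h}}
≤ C·Σ_i t_i − Σ_i s_i²`.  ONE fixed resolution (two coordination shells, 1 % tolerance): the deficit
`Σ_i t_i (C − n_i)`, `n_i = s_i²/t_i` the effective coordination, prices coordination defects, surfaces,
polytetrahedral order and c-type (fcc-like) layers, together with the bounded elastic haloes around them;
why it might fail = why the crux might: a ground-state family with `Σs² > Φ(hcp) Σt` (variance beating
the participation deficit), or deficit-free non-hcp two-shell environments.  It CONTAINS crux 11859
`GroundStateVarianceCertificate` pinned at hcp for `N ≥ 19` (take `# ≥ 0`); the threshold 19 = ⌊C⌋ + 2 is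
exactly where the trivial participation bound `n_i ≤ N − 1` stops paying.  Leans on:
`BarlowStackingEnergy`, `HcpSiteGeometry`; numerics of the route (hcp 17.2222, fcc 17.2204, TCP ≤ 15.8). -/
theorem stub_pricingLarge : ∀ (a h : ℝ) (ha : 0 < a) (hh : 0 < h), (∀ (a' h' : ℝ) (ha' : a' ≠ 0) (hh' : h' ≠ 0), (Literature.MathematicalPhysics.StatisticalMechanics.hcpPeriodicConfiguration ha.ne' hh.ne').energyPerParticle Literature.MathematicalPhysics.StatisticalMechanics.lennardJones ≤ (Literature.MathematicalPhysics.StatisticalMechanics.hcpPeriodicConfiguration ha' hh').energyPerParticle Literature.MathematicalPhysics.StatisticalMechanics.lennardJones) → ∃ c₀ : ℝ, 0 < c₀ ∧ ∀ (N : ℕ) (x : Fin N → EuclideanSpace ℝ (Fin 3)), Literature.MathematicalPhysics.StatisticalMechanics.IsGroundState Literature.MathematicalPhysics.StatisticalMechanics.lennardJones x → 19 ≤ N → c₀ * (Nat.card {i : Fin N // ¬ (∃ A : EuclideanSpace ℝ (Fin 3) →ₗᵢ[ℝ] EuclideanSpace ℝ (Fin 3), (∀ p ∈ (Literature.MathematicalPhysics.StatisticalMechanics.hcpPeriodicConfiguration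 ha.ne' hh.ne').points, ‖p‖ ≤ 2 * a → ∃ k : Fin N, dist (x k) (x i + A p) ≤ a / 100) ∧ (∀ k : Fin N, dist (x k) (x i) ≤ 2 * a → ∃ p ∈ (Literature.MathematicalPhysics.StatisticalMechanics.hcpPeriodicConfiguration ha.ne' hh.ne').points, dist (x k) (x i + A p) ≤ a / 100))} : ℝ) ≤ (-(24 : ℝ) * (Literature.MathematicalPhysics.StatisticalMechanics.hcpPeriodicConfiguration ha.ne' hh.ne').energyPerParticle Literature.MathematicalPhysics.StatisticalMechanics.lennardJones) * ∑ i, Literature.MathematicalPhysics.StatisticalMechanics.siteEnergy (fun r => (r⁻¹) ^ 12) x i - ∑ i, (Literature.MathematicalPhysics.StatisticalMechanics.siteEnergy (fun r => (r⁻¹) ^ 6) x i) ^ 2 := by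
  sorry

/-- **STUB 2 — coarse-to-fine rigidity with scale pinning** (size L/XL; deficit-free).  For every
optimal hcp pair `(a, h)` and every `R, ε > 0` there is `L > 0` such that in every Lennard-Jones ground
state `x`: if every particle `x_j` with `|x_j − x_i| ≤ L` has its `2a`-window `(a/100)`-congruent to a
window of `hcp_{a,h}`, then the `R`-window at `x_i` is `ε`-congruent to a window of `hcp_{a,h}`.
Why plausible: two-shell hcp windows at 1 % overlap rigidly (no c-layer, no dislocation core, no
vacancy inside the ball), so `B(x_i, L)` is one coherently oriented defect-free hcp crystal with strain
`≤ 1/200`; for an equilibrium configuration the sources of internal stress are defects and the free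
surface, all at distance `≥ L`, so strain and rotation gradients at the centre are `O(1/L)`
(interior regularity), and a defect-free region of radius `≳ 1/(K η²)` homogeneously strained by `η`
against the OPTIMAL `(a, h)` admits an energy-lowering compactly supported compression, impossible in a
ground state — so the lattice parameters at the centre are pinned to `(a, h)` within `O(L^{-1/2})`.
False for a non-optimal template (hence the optimality hypothesis); vacuous when `L` exceeds the
cluster diameter (convex-hull vertices are always coarse-bad).  Leans on: `FlatleyTheil2015`-type
discrete rigidity, `LocalMatchingCompactness`, `hcpPeriodicConfiguration_points`, `le_dist_barlowPos`. -/
theorem stub_coarseToFine : ∀ (a h : ℝ) (ha : 0 < a) (hh : 0 < h), (∀ (a' h' : ℝ) (ha' : a' ≠ 0) (hh' : h' ≠ 0), (Literature.MathematicalPhysics.StatisticalMechanics.hcpPeriodicConfiguration ha.ne' hh.ne').energyPerParticle Literature.MathematicalPhysics.StatisticalMechanics.lennardJones ≤ (Literature.MathematicalPhysics.StatisticalMechanics.hcpPeriodicConfiguration ha' hh').energyPerParticle Literature.MathematicalPhysics.StatisticalMechanics.lennardJones) → ∀ R ε : ℝ, 0 < R → 0 < ε → ∃ L : ℝ, 0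 < L ∧ ∀ (N : ℕ) (x : Fin N → EuclideanSpace ℝ (Fin 3)), Literature.MathematicalPhysics.StatisticalMechanics.IsGroundState Literature.MathematicalPhysics.StatisticalMechanics.lennardJones x → ∀ i : Fin N, (∀ j : Fin N, dist (x j) (x i) ≤ L → (∃ A : EuclideanSpace ℝ (Fin 3) →ₗᵢ[ℝ] EuclideanSpace ℝ (Fin 3), (∀ p ∈ (Literature.MathematicalPhysics.StatisticalMechanics.hcpPeriodicConfiguration ha.ne' hh.ne').points, ‖p‖ ≤ 2 * a → ∃ k : Fin N, dist (x k) (x j + A p) ≤ a / 100) ∧ (∀ k : Fin N, dist (x k) (x j) ≤ 2 * a → ∃ p ∈ (Literature.MathematicalPhysics.StatisticalMechanics.hcpPeriodicConfiguration ha.ne' hh.ne').points, dist (x k) (x j + A p) ≤ a / 100))) → (∃ A : EuclideanSpace ℝ (Fin 3) →ₗᵢ[ℝ] EuclideanSpace ℝ (Fin 3), (∀ p ∈ (Literature.MathematicalPhysics.StatisticalMechanics.hcpPeriodicConfiguration ha.ne' hh.ne').points, ‖p‖ ≤ R → ∃ k : Fin N, dist (x k) (x i + A p) ≤ ε) ∧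 (∀ k : Fin N, dist (x k) (x i) ≤ R → ∃ p ∈ (Literature.MathematicalPhysics.StatisticalMechanics.hcpPeriodicConfiguration ha.ne' hh.ne').points, dist (x k) (x i + A p) ≤ ε)) := by
  sorry

/-! ## The composition (kernel-checked, no `sorry` outside the stubs) -/

/-- **`birth` — the crux from the three stub STATEMENTS** (taken as hypotheses, so that the registered
stubs are exactly the open obligations): `P := hcp_{a,h}` from stub 0, `C, c₀` from stub 1, `L(R, ε)`
from stub 2, `δ` = uniform minimal distance of LJ ground states (proved Literature fact
`LennardJonesMinimalDistance_holds`), at most `K := (2L/δ + 1)³` particles within `L` of any particle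
(packing by volume, `card_le_of_separated_of_dist_le`), `c := c₀ / K`.  The conclusion is the crux's
signature VERBATIM (so this hypotheses form is not read as a conditional proof of the route decl);
`CoerciveVarianceCertificate_of_stubs` below instantiates it with the registered stubs at the route decl
BY NAME (definitional unfolding only). -/
theorem CoerciveVarianceCertificate_of_three : (∃ (a h : ℝ) (ha : 0 < a) (hh : 0 < h), (∀ (a' h' : ℝ) (ha' : a' ≠ 0) (hh' : h' ≠ 0), (Literature.MathematicalPhysics.StatisticalMechanics.hcpPeriodicConfiguration ha.ne' hh.ne').energyPerParticle Literature.MathematicalPhysics.StatisticalMechanics.lennardJones ≤ (Literature.MathematicalPhysics.StatisticalMechanics.hcpPeriodicConfiguration ha' hh').energyPerParticle Literature.MathematicalPhysics.StatisticalMechanics.lennardJones)) → (∀ (a h : ℝ) (ha : 0 < a) (hh : 0 < h), (∀ (a' h' : ℝ) (ha' : a' ≠ 0) (hh' : h' ≠ 0), (Literature.MathematicalPhysics.StatisticalMechanics.hcpPeriodicConfiguration ha.ne' hh.ne').energyPerParticle Literature.MathematicalPhysics.StatisticalMechanics.lennardJones ≤ (Literature.MathematicalPhysics.StatisticalMechanics.hcpPeriodicConfiguration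 ha' hh').energyPerParticle Literature.MathematicalPhysics.StatisticalMechanics.lennardJones) → ∃ C : ℝ, 0 < C ∧ (Literature.MathematicalPhysics.StatisticalMechanics.hcpPeriodicConfiguration ha.ne' hh.ne').energyPerParticle Literature.MathematicalPhysics.StatisticalMechanics.lennardJones ≤ -(C / 24) ∧ ∃ c₀ : ℝ, 0 < c₀ ∧ ∀ (N : ℕ) (x : Fin N → EuclideanSpace ℝ (Fin 3)), Literature.MathematicalPhysics.StatisticalMechanics.IsGroundState Literature.MathematicalPhysics.StatisticalMechanics.lennardJones x → 2 ≤ N → c₀ * (Nat.card {i : Fin N // ¬ (∃ A : EuclideanSpace ℝ (Fin 3) →ₗᵢ[ℝ] EuclideanSpace ℝ (Fin 3), (∀ p ∈ (Literature.MathematicalPhysics.StatisticalMechanics.hcpPeriodicConfiguration ha.ne' hh.ne').points, ‖p‖ ≤ 2 * a → ∃ k : Fin N, dist (x k) (x i + A p) ≤ a / 100) ∧ (∀ k : Fin N, dist (x k) (x i) ≤ 2 * a → ∃ p ∈ (Literature.MathematicalPhysics.StatisticalMechanics.hcpPeriodicConfiguration ha.ne' hh.ne').points, dist (x k) (x i +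 A p) ≤ a / 100))} : ℝ) ≤ C * ∑ i, Literature.MathematicalPhysics.StatisticalMechanics.siteEnergy (fun r => (r⁻¹) ^ 12) x i - ∑ i, (Literature.MathematicalPhysics.StatisticalMechanics.siteEnergy (fun r => (r⁻¹) ^ 6) x i) ^ 2) → (∀ (a h : ℝ) (ha : 0 < a) (hh : 0 < h), (∀ (a' h' : ℝ) (ha' : a' ≠ 0) (hh' : h' ≠ 0), (Literature.MathematicalPhysics.StatisticalMechanics.hcpPeriodicConfiguration ha.ne' hh.ne').energyPerParticle Literature.MathematicalPhysics.StatisticalMechanics.lennardJones ≤ (Literature.MathematicalPhysics.StatisticalMechanics.hcpPeriodicConfiguration ha' hh').energyPerParticle Literature.MathematicalPhysics.StatisticalMechanics.lennardJones) → ∀ R ε : ℝ, 0 < R → 0 < ε → ∃ L : ℝ, 0 < L ∧ ∀ (N : ℕ) (x : Fin N → EuclideanSpace ℝ (Fin 3)), Literature.MathematicalPhysics.StatisticalMechanics.IsGroundState Literature.MathematicalPhysics.StatisticalMechanics.lennardJones x → ∀ i : Fin N, (∀ j : Fin N, dist (x j) (x i) ≤ L → (∃ A : EuclideanSpace ℝ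 (Fin 3) →ₗᵢ[ℝ] EuclideanSpace ℝ (Fin 3), (∀ p ∈ (Literature.MathematicalPhysics.StatisticalMechanics.hcpPeriodicConfiguration ha.ne' hh.ne').points, ‖p‖ ≤ 2 * a → ∃ k : Fin N, dist (x k) (x j + A p) ≤ a / 100) ∧ (∀ k : Fin N, dist (x k) (x j) ≤ 2 * a → ∃ p ∈ (Literature.MathematicalPhysics.StatisticalMechanics.hcpPeriodicConfiguration ha.ne' hh.ne').points, dist (x k) (x j + A p) ≤ a / 100))) → (∃ A : EuclideanSpace ℝ (Fin 3) →ₗᵢ[ℝ] EuclideanSpace ℝ (Fin 3), (∀ p ∈ (Literature.MathematicalPhysics.StatisticalMechanics.hcpPeriodicConfiguration ha.ne' hh.ne').points, ‖p‖ ≤ R → ∃ k : Fin N, dist (x k) (x i + A p) ≤ ε) ∧ (∀ k : Fin N, dist (x k) (x i) ≤ R → ∃ p ∈ (Literature.MathematicalPhysics.StatisticalMechanics.hcpPeriodicConfiguration ha.ne' hh.ne').points, dist (x k) (x i + A p) ≤ ε))) → (∃ (P : Literature.MathematicalPhysics.StatisticalMechanics.PeriodicConfiguration 3) (C : ℝ),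 0 < C ∧ P.energyPerParticle Literature.MathematicalPhysics.StatisticalMechanics.lennardJones ≤ -(C / 24) ∧ ∀ R ε : ℝ, 0 < R → 0 < ε → ∃ c : ℝ, 0 < c ∧ ∀ (N : ℕ) (x : Fin N → EuclideanSpace ℝ (Fin 3)), Literature.MathematicalPhysics.StatisticalMechanics.IsGroundState Literature.MathematicalPhysics.StatisticalMechanics.lennardJones x → 2 ≤ N → c * (Nat.card {i : Fin N // ¬ ∃ A : EuclideanSpace ℝ (Fin 3) →ₗᵢ[ℝ] EuclideanSpace ℝ (Fin 3), (∀ p ∈ P.points, ‖p‖ ≤ R → ∃ j : Fin N, dist (x j) (x i + A p) ≤ ε) ∧ (∀ j : Fin N, dist (x j) (x i) ≤ R → ∃ p ∈ P.points, dist (x j) (x i + A p) ≤ ε)} : ℝ) ≤ C * ∑ i, Literature.MathematicalPhysics.StatisticalMechanics.siteEnergy (fun r => (r⁻¹) ^ 12) x i - ∑ i, (Literature.MathematicalPhysics.StatisticalMechanics.siteEnergy (fun r => (r⁻¹) ^ 6) x i) ^ 2) := by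
  intro h0 h1 h2
  obtain ⟨a, h, ha, hh, hopt⟩ := h0
  obtain ⟨C, hC, heP, c₀, hc₀, hprice⟩ := h1 a h ha hh hopt
  refine ⟨(Literature.MathematicalPhysics.StatisticalMechanics.hcpPeriodicConfiguration ha.ne' hh.ne'), C, hC, heP, ?_⟩
  intro R ε hR hε
  obtain ⟨L, hL, hrig⟩ := h2 a h ha hh hopt R ε hR hε
  obtain ⟨δ, hδ, hsep⟩ := Literature.MathematicalPhysics.StatisticalMechanics.LennardJonesMinimalDistance_holds
  have hKpos : (0 : ℝ) < (2 * L / δ + 1) ^ 3 := by positivity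
  refine ⟨c₀ / (2 * L / δ + 1) ^ 3, div_pos hc₀ hKpos, ?_⟩
  intro N x hx hN
  classical
  -- abbreviations for the two defect predicates (fine = the crux's, coarse = the stubs')
  set Bad : Fin N → Prop := fun i => ¬ (∃ A : EuclideanSpace ℝ (Fin 3) →ₗᵢ[ℝ] EuclideanSpace ℝ (Fin 3), (∀ p ∈ (Literature.MathematicalPhysics.StatisticalMechanics.hcpPeriodicConfiguration ha.ne' hh.ne').points, ‖p‖ ≤ R → ∃ k : Fin N, dist (x k) (x i + A p) ≤ ε) ∧ (∀ k : Fin N, dist (x k) (x i) ≤ R → ∃ p ∈ (Literature.MathematicalPhysics.StatisticalMechanics.hcpPeriodicConfiguration ha.ne' hh.ne').points, dist (x k) (x i + A p) ≤ ε)) with hBad_def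
  set Bad₀ : Fin N → Prop := fun i => ¬ (∃ A : EuclideanSpace ℝ (Fin 3) →ₗᵢ[ℝ] EuclideanSpace ℝ (Fin 3), (∀ p ∈ (Literature.MathematicalPhysics.StatisticalMechanics.hcpPeriodicConfiguration ha.ne' hh.ne').points, ‖p‖ ≤ 2 * a → ∃ k : Fin N, dist (x k) (x i + A p) ≤ a / 100) ∧ (∀ k : Fin N, dist (x k) (x i) ≤ 2 * a → ∃ p ∈ (Literature.MathematicalPhysics.StatisticalMechanics.hcpPeriodicConfiguration ha.ne' hh.ne').points, dist (x k) (x i + A p) ≤ a / 100)) with hBad₀_def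
  -- (1) every fine-bad particle has a coarse-bad particle within `L` (contrapositive of rigidity)
  have hnear : ∀ i, Bad i → ∃ j, dist (x j) (x i) ≤ L ∧ Bad₀ j := by
    intro i hi
    by_contra hcon
    exact hi (hrig N x hx i fun j hj => by_contra fun hj' => hcon ⟨j, hj, hj'⟩)
  -- (2) packing: at most `K` particles within `L` of any particle
  have hpack : ∀ j : Fin N,
      ((Finset.univ.filter fun i : Fin N => dist (x j) (x i) ≤ L).card : ℝ) ≤ (2 * L / δ + 1) ^ 3 := by
    intro j
    set S := Finset.univ.filter fun i : Fin N => dist (x j) (x i) ≤ L with hS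
    have hcard : (S.image x).card = S.card := Finset.card_image_of_injective S hx.1
    have h1 : ∀ c ∈ S.image x, dist c (x j) ≤ L := by
      intro c hc
      obtain ⟨i, hi, rfl⟩ := Finset.mem_image.1 hc
      rw [dist_comm]
      exact (Finset.mem_filter.1 hi).2
    have h2 : ∀ c ∈ S.image x, ∀ d ∈ S.image x, c ≠ d → δ ≤ dist c d := by
      intro c hc d hd hcd
      obtain ⟨i, -, rfl⟩ := Finset.mem_image.1 hc
      obtain ⟨i', -, rfl⟩ := Finset.mem_image.1 hd
      exact hsep N x hx i i' fun h => hcd (congrArg x h)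
    have h3 := Literature.MathematicalPhysics.StatisticalMechanics.card_le_of_separated_of_dist_le (S.image x) (x j) hδ hL.le h1 h2
    rw [finrank_euclideanSpace_fin, hcard] at h3
    exact h3
  -- (3) counting: `#Bad ≤ K · #Bad₀`
  have hcount : (Nat.card {i : Fin N // Bad i} : ℝ) ≤
      (2 * L / δ + 1) ^ 3 * (Nat.card {i : Fin N // Bad₀ i} : ℝ) := by
    have eB : Nat.card {i : Fin N // Bad i} = (Finset.univ.filter Bad).card := by
      rw [Nat.card_eq_fintype_card, Fintype.card_subtype]
    have eB₀ : Nat.card {i : Fin N // Bad₀ i} = (Finset.univ.filter Bad₀).card := by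
      rw [Nat.card_eq_fintype_card, Fintype.card_subtype]
    have hsub : Finset.univ.filter Bad ⊆
        (Finset.univ.filter Bad₀).biUnion fun j => Finset.univ.filter fun i : Fin N => dist (x j) (x i) ≤ L := by
      intro i hi
      obtain ⟨j, hj, hj₀⟩ := hnear i (Finset.mem_filter.1 hi).2
      exact Finset.mem_biUnion.2 ⟨j, Finset.mem_filter.2 ⟨Finset.mem_univ _, hj₀⟩,
        Finset.mem_filter.2 ⟨Finset.mem_univ _, hj⟩⟩
    have hle := (Finset.card_le_card hsub).trans Finset.card_biUnion_le
    rw [eB, eB₀]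
    calc ((Finset.univ.filter Bad).card : ℝ)
        ≤ ((∑ j ∈ Finset.univ.filter Bad₀,
            (Finset.univ.filter fun i : Fin N => dist (x j) (x i) ≤ L).card : ℕ) : ℝ) := by
          exact_mod_cast hle
      _ = ∑ j ∈ Finset.univ.filter Bad₀,
            ((Finset.univ.filter fun i : Fin N => dist (x j) (x i) ≤ L).card : ℝ) := by
          push_cast
          rfl
      _ ≤ ∑ _j ∈ Finset.univ.filter Bad₀, (2 * L / δ + 1) ^ 3 := Finset.sum_le_sum fun j _ => hpack j
      _ = (2 * L / δ + 1) ^ 3 * ((Finset.univ.filter Bad₀).card : ℝ) := by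
          rw [Finset.sum_const, nsmul_eq_mul, mul_comm]
  -- (4) the estimate
  have hfinal := hprice N x hx hN
  calc c₀ / (2 * L / δ + 1) ^ 3 * (Nat.card {i : Fin N // Bad i} : ℝ)
      ≤ c₀ / (2 * L / δ + 1) ^ 3 * ((2 * L / δ + 1) ^ 3 * (Nat.card {i : Fin N // Bad₀ i} : ℝ)) :=
        mul_le_mul_of_nonneg_left hcount (div_nonneg hc₀.le hKpos.le)
    _ = c₀ * (Nat.card {i : Fin N // Bad₀ i} : ℝ) := by
        field_simp
    _ ≤ _ := hfinal

/-- **Glue**: pinned pricing for all `N ≥ 2` from the energy bound, the small-cluster pricing and the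
large-`N` kernel (`c₀' := min (1/50) c₀`; `#bad ≤ N`). [folklore] -/
theorem pricing_of_small_large : (∀ (a h : ℝ) (ha : 0 < a) (hh : 0 < h), (∀ (a' h' : ℝ) (ha' : a' ≠ 0) (hh' : h' ≠ 0), (Literature.MathematicalPhysics.StatisticalMechanics.hcpPeriodicConfiguration ha.ne' hh.ne').energyPerParticle Literature.MathematicalPhysics.StatisticalMechanics.lennardJones ≤ (Literature.MathematicalPhysics.StatisticalMechanics.hcpPeriodicConfiguration ha' hh').energyPerParticle Literature.MathematicalPhysics.StatisticalMechanics.lennardJones) → (Literature.MathematicalPhysics.StatisticalMechanics.hcpPeriodicConfiguration ha.ne' hh.ne').energyPerParticle Literature.MathematicalPhysics.StatisticalMechanics.lennardJones ≤ -(7175 / 10000)) → (∀ (a h : ℝ) (ha : 0 < a) (hh : 0 < h), (Literature.MathematicalPhysics.StatisticalMechanics.hcpPeriodicConfiguration ha.ne' hh.ne').energyPerParticle Literature.MathematicalPhysics.StatisticalMechanics.lennardJones ≤ -(7175 / 10000) → ∀ (N : ℕ) (x : Fin N → EuclideanSpace ℝ (Fin 3)), Literature.MathematicalPhysics.StatisticalMechanics.IsGroundState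 Literature.MathematicalPhysics.StatisticalMechanics.lennardJones x → 2 ≤ N → N ≤ 18 → (1 / 50 : ℝ) * N ≤ (-(24 : ℝ) * (Literature.MathematicalPhysics.StatisticalMechanics.hcpPeriodicConfiguration ha.ne' hh.ne').energyPerParticle Literature.MathematicalPhysics.StatisticalMechanics.lennardJones) * ∑ i, Literature.MathematicalPhysics.StatisticalMechanics.siteEnergy (fun r => (r⁻¹) ^ 12) x i - ∑ i, (Literature.MathematicalPhysics.StatisticalMechanics.siteEnergy (fun r => (r⁻¹) ^ 6) x i) ^ 2) → (∀ (a h : ℝ) (ha : 0 < a) (hh : 0 < h), (∀ (a' h' : ℝ) (ha' : a' ≠ 0) (hh' : h' ≠ 0), (Literature.MathematicalPhysics.StatisticalMechanics.hcpPeriodicConfiguration ha.ne' hh.ne').energyPerParticle Literature.MathematicalPhysics.StatisticalMechanics.lennardJones ≤ (Literature.MathematicalPhysics.StatisticalMechanics.hcpPeriodicConfiguration ha' hh').energyPerParticle Literature.MathematicalPhysics.StatisticalMechanics.lennardJones) → ∃ c₀ : ℝ, 0 < c₀ ∧ ∀ (N : ℕ) (x : Fin N → EuclideanSpace ℝ (Fin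 3)), Literature.MathematicalPhysics.StatisticalMechanics.IsGroundState Literature.MathematicalPhysics.StatisticalMechanics.lennardJones x → 19 ≤ N → c₀ * (Nat.card {i : Fin N // ¬ (∃ A : EuclideanSpace ℝ (Fin 3) →ₗᵢ[ℝ] EuclideanSpace ℝ (Fin 3), (∀ p ∈ (Literature.MathematicalPhysics.StatisticalMechanics.hcpPeriodicConfiguration ha.ne' hh.ne').points, ‖p‖ ≤ 2 * a → ∃ k : Fin N, dist (x k) (x i + A p) ≤ a / 100) ∧ (∀ k : Fin N, dist (x k) (x i) ≤ 2 * a → ∃ p ∈ (Literature.MathematicalPhysics.StatisticalMechanics.hcpPeriodicConfiguration ha.ne' hh.ne').points, dist (x k) (x i + A p) ≤ a / 100))} : ℝ) ≤ (-(24 : ℝ) * (Literature.MathematicalPhysics.StatisticalMechanics.hcpPeriodicConfiguration ha.ne' hh.ne').energyPerParticle Literature.MathematicalPhysics.StatisticalMechanics.lennardJones) * ∑ i, Literature.MathematicalPhysics.StatisticalMechanics.siteEnergy (fun r => (r⁻¹) ^ 12) x i - ∑ i, (Literature.MathematicalPhysics.StatisticalMechanics.siteEnergy (fun r => (r⁻¹)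 ^ 6) x i) ^ 2) → (∀ (a h : ℝ) (ha : 0 < a) (hh : 0 < h), (∀ (a' h' : ℝ) (ha' : a' ≠ 0) (hh' : h' ≠ 0), (Literature.MathematicalPhysics.StatisticalMechanics.hcpPeriodicConfiguration ha.ne' hh.ne').energyPerParticle Literature.MathematicalPhysics.StatisticalMechanics.lennardJones ≤ (Literature.MathematicalPhysics.StatisticalMechanics.hcpPeriodicConfiguration ha' hh').energyPerParticle Literature.MathematicalPhysics.StatisticalMechanics.lennardJones) → ∃ c₀ : ℝ, 0 < c₀ ∧ ∀ (N : ℕ) (x : Fin N → EuclideanSpace ℝ (Fin 3)), Literature.MathematicalPhysics.StatisticalMechanics.IsGroundState Literature.MathematicalPhysics.StatisticalMechanics.lennardJones x → 2 ≤ N → c₀ * (Nat.card {i : Fin N // ¬ (∃ A : EuclideanSpace ℝ (Fin 3) →ₗᵢ[ℝ] EuclideanSpace ℝ (Fin 3), (∀ p ∈ (Literature.MathematicalPhysics.StatisticalMechanics.hcpPeriodicConfiguration ha.ne' hh.ne').points, ‖p‖ ≤ 2 * a → ∃ k : Fin N, dist (x k) (x i + A p) ≤ a / 100) ∧ (∀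 k : Fin N, dist (x k) (x i) ≤ 2 * a → ∃ p ∈ (Literature.MathematicalPhysics.StatisticalMechanics.hcpPeriodicConfiguration ha.ne' hh.ne').points, dist (x k) (x i + A p) ≤ a / 100))} : ℝ) ≤ (-(24 : ℝ) * (Literature.MathematicalPhysics.StatisticalMechanics.hcpPeriodicConfiguration ha.ne' hh.ne').energyPerParticle Literature.MathematicalPhysics.StatisticalMechanics.lennardJones) * ∑ i, Literature.MathematicalPhysics.StatisticalMechanics.siteEnergy (fun r => (r⁻¹) ^ 12) x i - ∑ i, (Literature.MathematicalPhysics.StatisticalMechanics.siteEnergy (fun r => (r⁻¹) ^ 6) x i) ^ 2) := by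
  intro hE hS hL a h ha hh hopt
  obtain ⟨c₀, hc₀, hlarge⟩ := hL a h ha hh hopt
  refine ⟨min (1 / 50) c₀, lt_min (by norm_num) hc₀, ?_⟩
  intro N x hx hN
  have hcard : (Nat.card {i : Fin N // ¬ (∃ A : EuclideanSpace ℝ (Fin 3) →ₗᵢ[ℝ] EuclideanSpace ℝ (Fin 3), (∀ p ∈ (Literature.MathematicalPhysics.StatisticalMechanics.hcpPeriodicConfiguration ha.ne' hh.ne').points, ‖p‖ ≤ 2 * a → ∃ k : Fin N, dist (x k) (x i + A p) ≤ a / 100) ∧ (∀ k : Fin N, dist (x k) (x i) ≤ 2 * a → ∃ p ∈ (Literature.MathematicalPhysics.StatisticalMechanics.hcpPeriodicConfiguration ha.ne' hh.ne').points, dist (x k) (x i + A p) ≤ a / 100))} : ℝ) ≤ N := by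
    classical
    rw [Nat.card_eq_fintype_card]
    exact_mod_cast (Fintype.card_subtype_le _).trans_eq (Fintype.card_fin N)
  have hcard0 : (0 : ℝ) ≤ (Nat.card {i : Fin N // ¬ (∃ A : EuclideanSpace ℝ (Fin 3) →ₗᵢ[ℝ] EuclideanSpace ℝ (Fin 3), (∀ p ∈ (Literature.MathematicalPhysics.StatisticalMechanics.hcpPeriodicConfiguration ha.ne' hh.ne').points, ‖p‖ ≤ 2 * a → ∃ k : Fin N, dist (x k) (x i + A p) ≤ a / 100) ∧ (∀ k : Fin N, dist (x k) (x i) ≤ 2 * a → ∃ p ∈ (Literature.MathematicalPhysics.StatisticalMechanics.hcpPeriodicConfiguration ha.ne' hh.ne').points, dist (x k) (x i + A p) ≤ a / 100))} : ℝ) := Nat.cast_nonneg _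
  by_cases hsmall : N ≤ 18
  · have h1 := hS a h ha hh (hE a h ha hh hopt) N x hx hN hsmall
    calc min (1 / 50) c₀ * (Nat.card {i : Fin N // ¬ (∃ A : EuclideanSpace ℝ (Fin 3) →ₗᵢ[ℝ] EuclideanSpace ℝ (Fin 3), (∀ p ∈ (Literature.MathematicalPhysics.StatisticalMechanics.hcpPeriodicConfiguration ha.ne' hh.ne').points, ‖p‖ ≤ 2 * a → ∃ k : Fin N, dist (x k) (x i + A p) ≤ a / 100) ∧ (∀ k : Fin N, dist (x k) (x i) ≤ 2 * a → ∃ p ∈ (Literature.MathematicalPhysics.StatisticalMechanics.hcpPeriodicConfiguration ha.ne' hh.ne').points, dist (x k) (x i + A p) ≤ a / 100))} : ℝ)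
        ≤ (1 / 50) * (N : ℝ) :=
          mul_le_mul (min_le_left _ _) hcard hcard0 (by norm_num)
      _ ≤ _ := h1
  · have h1 := hlarge N x hx (by omega)
    calc min (1 / 50) c₀ * (Nat.card {i : Fin N // ¬ (∃ A : EuclideanSpace ℝ (Fin 3) →ₗᵢ[ℝ] EuclideanSpace ℝ (Fin 3), (∀ p ∈ (Literature.MathematicalPhysics.StatisticalMechanics.hcpPeriodicConfiguration ha.ne' hh.ne').points, ‖p‖ ≤ 2 * a → ∃ k : Fin N, dist (x k) (x i + A p) ≤ a / 100) ∧ (∀ k : Fin N, dist (x k) (x i) ≤ 2 * a → ∃ p ∈ (Literature.MathematicalPhysics.StatisticalMechanics.hcpPeriodicConfiguration ha.ne' hh.ne').points, dist (x k) (x i + A p) ≤ a / 100))} : ℝ)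
        ≤ c₀ * (Nat.card {i : Fin N // ¬ (∃ A : EuclideanSpace ℝ (Fin 3) →ₗᵢ[ℝ] EuclideanSpace ℝ (Fin 3), (∀ p ∈ (Literature.MathematicalPhysics.StatisticalMechanics.hcpPeriodicConfiguration ha.ne' hh.ne').points, ‖p‖ ≤ 2 * a → ∃ k : Fin N, dist (x k) (x i + A p) ≤ a / 100) ∧ (∀ k : Fin N, dist (x k) (x i) ≤ 2 * a → ∃ p ∈ (Literature.MathematicalPhysics.StatisticalMechanics.hcpPeriodicConfiguration ha.ne' hh.ne').points, dist (x k) (x i + A p) ≤ a / 100))} : ℝ) :=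
          mul_le_mul_of_nonneg_right (min_le_right _ _) hcard0
      _ ≤ _ := h1

/-- **Glue**: the pinned pair (energy bound, pinned pricing) gives the free-constant coarse pricing
statement consumed by `CoerciveVarianceCertificate_of_three` (`C := −24·e`, `0 < C` from `e ≤ −0.7175`,
`e = −C/24`). [folklore] -/
theorem coarsePricing_of_pinned : (∀ (a h : ℝ) (ha : 0 < a) (hh : 0 < h), (∀ (a' h' : ℝ) (ha' : a' ≠ 0) (hh' : h' ≠ 0), (Literature.MathematicalPhysics.StatisticalMechanics.hcpPeriodicConfiguration ha.ne' hh.ne').energyPerParticle Literature.MathematicalPhysics.StatisticalMechanics.lennardJones ≤ (Literature.MathematicalPhysics.StatisticalMechanics.hcpPeriodicConfiguration ha' hh').energyPerParticle Literature.MathematicalPhysics.StatisticalMechanics.lennardJones) → (Literature.MathematicalPhysics.StatisticalMechanics.hcpPeriodicConfiguration ha.ne' hh.ne').energyPerParticle Literature.MathematicalPhysics.StatisticalMechanics.lennardJones ≤ -(7175 / 10000)) → (∀ (a h : ℝ) (ha : 0 < a) (hh : 0 < h), (∀ (a' h' : ℝ) (ha' : a' ≠ 0) (hh' : h' ≠ 0),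 (Literature.MathematicalPhysics.StatisticalMechanics.hcpPeriodicConfiguration ha.ne' hh.ne').energyPerParticle Literature.MathematicalPhysics.StatisticalMechanics.lennardJones ≤ (Literature.MathematicalPhysics.StatisticalMechanics.hcpPeriodicConfiguration ha' hh').energyPerParticle Literature.MathematicalPhysics.StatisticalMechanics.lennardJones) → ∃ c₀ : ℝ, 0 < c₀ ∧ ∀ (N : ℕ) (x : Fin N → EuclideanSpace ℝ (Fin 3)), Literature.MathematicalPhysics.StatisticalMechanics.IsGroundState Literature.MathematicalPhysics.StatisticalMechanics.lennardJones x → 2 ≤ N → c₀ * (Nat.card {i : Fin N // ¬ (∃ A : EuclideanSpace ℝ (Fin 3) →ₗᵢ[ℝ] EuclideanSpace ℝ (Fin 3), (∀ p ∈ (Literature.MathematicalPhysics.StatisticalMechanics.hcpPeriodicConfiguration ha.ne' hh.ne').points, ‖p‖ ≤ 2 * a → ∃ k : Fin N, dist (x k) (x i + A p) ≤ a / 100) ∧ (∀ k : Fin N, dist (x k) (x i) ≤ 2 * a → ∃ p ∈ (Literature.MathematicalPhysics.StatisticalMechanics.hcpPeriodicConfiguration ha.ne' hh.ne').points, dist (x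 k) (x i + A p) ≤ a / 100))} : ℝ) ≤ (-(24 : ℝ) * (Literature.MathematicalPhysics.StatisticalMechanics.hcpPeriodicConfiguration ha.ne' hh.ne').energyPerParticle Literature.MathematicalPhysics.StatisticalMechanics.lennardJones) * ∑ i, Literature.MathematicalPhysics.StatisticalMechanics.siteEnergy (fun r => (r⁻¹) ^ 12) x i - ∑ i, (Literature.MathematicalPhysics.StatisticalMechanics.siteEnergy (fun r => (r⁻¹) ^ 6) x i) ^ 2) → (∀ (a h : ℝ) (ha : 0 < a) (hh : 0 < h), (∀ (a' h' : ℝ) (ha' : a' ≠ 0) (hh' : h' ≠ 0), (Literature.MathematicalPhysics.StatisticalMechanics.hcpPeriodicConfiguration ha.ne' hh.ne').energyPerParticle Literature.MathematicalPhysics.StatisticalMechanics.lennardJones ≤ (Literature.MathematicalPhysics.StatisticalMechanics.hcpPeriodicConfiguration ha' hh').energyPerParticle Literature.MathematicalPhysics.StatisticalMechanics.lennardJones) → ∃ C : ℝ, 0 < C ∧ (Literature.MathematicalPhysics.StatisticalMechanics.hcpPeriodicConfiguration ha.ne' hh.ne').energyPerParticle Literature.MathematicalPhysics.StatisticalMechanics.lennardJones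 ≤ -(C / 24) ∧ ∃ c₀ : ℝ, 0 < c₀ ∧ ∀ (N : ℕ) (x : Fin N → EuclideanSpace ℝ (Fin 3)), Literature.MathematicalPhysics.StatisticalMechanics.IsGroundState Literature.MathematicalPhysics.StatisticalMechanics.lennardJones x → 2 ≤ N → c₀ * (Nat.card {i : Fin N // ¬ (∃ A : EuclideanSpace ℝ (Fin 3) →ₗᵢ[ℝ] EuclideanSpace ℝ (Fin 3), (∀ p ∈ (Literature.MathematicalPhysics.StatisticalMechanics.hcpPeriodicConfiguration ha.ne' hh.ne').points, ‖p‖ ≤ 2 * a → ∃ k : Fin N, dist (x k) (x i + A p) ≤ a / 100) ∧ (∀ k : Fin N, dist (x k) (x i) ≤ 2 * a → ∃ p ∈ (Literature.MathematicalPhysics.StatisticalMechanics.hcpPeriodicConfiguration ha.ne' hh.ne').points, dist (x k) (x i + A p) ≤ a / 100))} : ℝ) ≤ C * ∑ i, Literature.MathematicalPhysics.StatisticalMechanics.siteEnergy (fun r => (r⁻¹) ^ 12) x i - ∑ i, (Literature.MathematicalPhysics.StatisticalMechanics.siteEnergy (fun r => (r⁻¹) ^ 6) x i) ^ 2) :=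 by
  intro hE hP a h ha hh hopt
  obtain ⟨c₀, hc₀, hprice⟩ := hP a h ha hh hopt
  have he := hE a h ha hh hopt
  refine ⟨-(24 : ℝ) * (Literature.MathematicalPhysics.StatisticalMechanics.hcpPeriodicConfiguration ha.ne' hh.ne').energyPerParticle Literature.MathematicalPhysics.StatisticalMechanics.lennardJones, by linarith, by linarith, c₀, hc₀, ?_⟩
  intro N x hx hN
  exact hprice N x hx hN

/-- **`birth` (reshaped by lead c1: 5 stubs) — the crux from the five stub STATEMENTS** taken as
hypotheses: `stub_optimalHcp`, `stub_hcpEnergyBound`, `stub_pricingSmall`, `stub_pricingLarge`,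
`stub_coarseToFine`; conclusion = the crux's signature VERBATIM. -/
theorem CoerciveVarianceCertificate_of : (∃ (a h : ℝ) (ha : 0 < a) (hh : 0 < h), (∀ (a' h' : ℝ) (ha' : a' ≠ 0) (hh' : h' ≠ 0), (Literature.MathematicalPhysics.StatisticalMechanics.hcpPeriodicConfiguration ha.ne' hh.ne').energyPerParticle Literature.MathematicalPhysics.StatisticalMechanics.lennardJones ≤ (Literature.MathematicalPhysics.StatisticalMechanics.hcpPeriodicConfiguration ha' hh').energyPerParticle Literature.MathematicalPhysics.StatisticalMechanics.lennardJones)) → (∀ (a h : ℝ) (ha : 0 < a) (hh : 0 < h), (∀ (a' h' : ℝ) (ha' : a' ≠ 0) (hh' : h' ≠ 0), (Literature.MathematicalPhysics.StatisticalMechanics.hcpPeriodicConfiguration ha.ne' hh.ne').energyPerParticle Literature.MathematicalPhysics.StatisticalMechanics.lennardJones ≤ (Literature.MathematicalPhysics.StatisticalMechanics.hcpPeriodicConfiguration ha' hh').energyPerParticle Literature.MathematicalPhysics.StatisticalMechanics.lennardJones) → (Literature.MathematicalPhysics.StatisticalMechanics.hcpPeriodicConfiguration ha.ne' hh.ne').energyPerParticle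 Literature.MathematicalPhysics.StatisticalMechanics.lennardJones ≤ -(7175 / 10000)) → (∀ (a h : ℝ) (ha : 0 < a) (hh : 0 < h), (Literature.MathematicalPhysics.StatisticalMechanics.hcpPeriodicConfiguration ha.ne' hh.ne').energyPerParticle Literature.MathematicalPhysics.StatisticalMechanics.lennardJones ≤ -(7175 / 10000) → ∀ (N : ℕ) (x : Fin N → EuclideanSpace ℝ (Fin 3)), Literature.MathematicalPhysics.StatisticalMechanics.IsGroundState Literature.MathematicalPhysics.StatisticalMechanics.lennardJones x → 2 ≤ N → N ≤ 18 → (1 / 50 : ℝ) * N ≤ (-(24 : ℝ) * (Literature.MathematicalPhysics.StatisticalMechanics.hcpPeriodicConfiguration ha.ne' hh.ne').energyPerParticle Literature.MathematicalPhysics.StatisticalMechanics.lennardJones) * ∑ i, Literature.MathematicalPhysics.StatisticalMechanics.siteEnergy (fun r => (r⁻¹) ^ 12) x i - ∑ i, (Literature.MathematicalPhysics.StatisticalMechanics.siteEnergy (fun r => (r⁻¹) ^ 6) x i) ^ 2) → (∀ (a h : ℝ) (ha : 0 < a) (hh : 0 < h), (∀ (a' h' : ℝ) (ha' : a' ≠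 0) (hh' : h' ≠ 0), (Literature.MathematicalPhysics.StatisticalMechanics.hcpPeriodicConfiguration ha.ne' hh.ne').energyPerParticle Literature.MathematicalPhysics.StatisticalMechanics.lennardJones ≤ (Literature.MathematicalPhysics.StatisticalMechanics.hcpPeriodicConfiguration ha' hh').energyPerParticle Literature.MathematicalPhysics.StatisticalMechanics.lennardJones) → ∃ c₀ : ℝ, 0 < c₀ ∧ ∀ (N : ℕ) (x : Fin N → EuclideanSpace ℝ (Fin 3)), Literature.MathematicalPhysics.StatisticalMechanics.IsGroundState Literature.MathematicalPhysics.StatisticalMechanics.lennardJones x → 19 ≤ N → c₀ * (Nat.card {i : Fin N // ¬ (∃ A : EuclideanSpace ℝ (Fin 3) →ₗᵢ[ℝ] EuclideanSpace ℝ (Fin 3), (∀ p ∈ (Literature.MathematicalPhysics.StatisticalMechanics.hcpPeriodicConfiguration ha.ne' hh.ne').points, ‖p‖ ≤ 2 * a → ∃ k : Fin N, dist (x k) (x i + A p) ≤ a / 100) ∧ (∀ k : Fin N, dist (x k) (x i) ≤ 2 * a → ∃ p ∈ (Literature.MathematicalPhysics.StatisticalMechanics.hcpPeriodicConfiguration ha.ne'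 hh.ne').points, dist (x k) (x i + A p) ≤ a / 100))} : ℝ) ≤ (-(24 : ℝ) * (Literature.MathematicalPhysics.StatisticalMechanics.hcpPeriodicConfiguration ha.ne' hh.ne').energyPerParticle Literature.MathematicalPhysics.StatisticalMechanics.lennardJones) * ∑ i, Literature.MathematicalPhysics.StatisticalMechanics.siteEnergy (fun r => (r⁻¹) ^ 12) x i - ∑ i, (Literature.MathematicalPhysics.StatisticalMechanics.siteEnergy (fun r => (r⁻¹) ^ 6) x i) ^ 2) → (∀ (a h : ℝ) (ha : 0 < a) (hh : 0 < h), (∀ (a' h' : ℝ) (ha' : a' ≠ 0) (hh' : h' ≠ 0), (Literature.MathematicalPhysics.StatisticalMechanics.hcpPeriodicConfiguration ha.ne' hh.ne').energyPerParticle Literature.MathematicalPhysics.StatisticalMechanics.lennardJones ≤ (Literature.MathematicalPhysics.StatisticalMechanics.hcpPeriodicConfiguration ha' hh').energyPerParticle Literature.MathematicalPhysics.StatisticalMechanics.lennardJones) → ∀ R ε : ℝ, 0 < R → 0 < ε → ∃ L : ℝ, 0 < L ∧ ∀ (N : ℕ) (x : Fin N → EuclideanSpace ℝ (Fin 3)),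 Literature.MathematicalPhysics.StatisticalMechanics.IsGroundState Literature.MathematicalPhysics.StatisticalMechanics.lennardJones x → ∀ i : Fin N, (∀ j : Fin N, dist (x j) (x i) ≤ L → (∃ A : EuclideanSpace ℝ (Fin 3) →ₗᵢ[ℝ] EuclideanSpace ℝ (Fin 3), (∀ p ∈ (Literature.MathematicalPhysics.StatisticalMechanics.hcpPeriodicConfiguration ha.ne' hh.ne').points, ‖p‖ ≤ 2 * a → ∃ k : Fin N, dist (x k) (x j + A p) ≤ a / 100) ∧ (∀ k : Fin N, dist (x k) (x j) ≤ 2 * a → ∃ p ∈ (Literature.MathematicalPhysics.StatisticalMechanics.hcpPeriodicConfiguration ha.ne' hh.ne').points, dist (x k) (x j + A p) ≤ a / 100))) → (∃ A : EuclideanSpace ℝ (Fin 3) →ₗᵢ[ℝ] EuclideanSpace ℝ (Fin 3), (∀ p ∈ (Literature.MathematicalPhysics.StatisticalMechanics.hcpPeriodicConfiguration ha.ne' hh.ne').points, ‖p‖ ≤ R → ∃ k : Fin N, dist (x k) (x i + A p) ≤ ε) ∧ (∀ k : Fin N, dist (x k) (x i) ≤ R → ∃ p ∈ (Literature.MathematicalPhysics.StatisticalMechanics.hcpPeriodicConfiguration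 ha.ne' hh.ne').points, dist (x k) (x i + A p) ≤ ε))) → (∃ (P : Literature.MathematicalPhysics.StatisticalMechanics.PeriodicConfiguration 3) (C : ℝ), 0 < C ∧ P.energyPerParticle Literature.MathematicalPhysics.StatisticalMechanics.lennardJones ≤ -(C / 24) ∧ ∀ R ε : ℝ, 0 < R → 0 < ε → ∃ c : ℝ, 0 < c ∧ ∀ (N : ℕ) (x : Fin N → EuclideanSpace ℝ (Fin 3)), Literature.MathematicalPhysics.StatisticalMechanics.IsGroundState Literature.MathematicalPhysics.StatisticalMechanics.lennardJones x → 2 ≤ N → c * (Nat.card {i : Fin N // ¬ ∃ A : EuclideanSpace ℝ (Fin 3) →ₗᵢ[ℝ] EuclideanSpace ℝ (Fin 3), (∀ p ∈ P.points, ‖p‖ ≤ R → ∃ j : Fin N, dist (x j) (x i + A p) ≤ ε) ∧ (∀ j : Fin N, dist (x j) (x i) ≤ R → ∃ p ∈ P.points, dist (x j) (x i + A p) ≤ ε)} : ℝ) ≤ C * ∑ i, Literature.MathematicalPhysics.StatisticalMechanics.siteEnergy (fun r => (r⁻¹) ^ 12) x i - ∑ i, (Literature.MathematicalPhysics.StatisticalMechanics.siteEnergy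 (fun r => (r⁻¹) ^ 6) x i) ^ 2) :=
  fun h0 hE hS hL h2 =>
    CoerciveVarianceCertificate_of_three h0 (coarsePricing_of_pinned hE (pricing_of_small_large hE hS hL)) h2

/-- **The crux BY NAME from the registered stubs** (type literally the route decl; the only `sorry`s in
its cone are `stub_optimalHcp`, `stub_hcpEnergyBound`, `stub_pricingSmall`, `stub_pricingLarge`,
`stub_coarseToFine`). -/
theorem CoerciveVarianceCertificate_of_stubs : Summit.AtomisticToContinuum.Crystallization.Theses.PRVarianceCertificate.CoerciveVarianceCertificate :=
  CoerciveVarianceCertificate_of stub_optimalHcp stub_hcpEnergyBound stub_pricingSmall stub_pricingLarge stub_coarseToFine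

end Summit.AtomisticToContinuum.Crystallization.Cruxes.CoerciveVarianceCertificate.Birth

end
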